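import Literature.MathematicalPhysics.QuantumLattice.HubbardGroundStateSpinCorrelationSigns
import HarnessLib

/-!
# `SU(2)` scalars are constant on Lieb's ground multiplet: Shen–Qiu–Tian's sign rule and the
# ferrimagnetic floor for EVERY half-filled ground state (Tasaki 1998, Theorem 5.3 and §5.3)

Topic `MathematicalPhysics/QuantumLattice` (family `hubbard`). Cell `pub/hubbard-cq`, seat
`hubbard-pc-lit-1`. Companion of `HubbardGroundStateSpinCorrelationSigns` (the sign rule and the
ferrimagnetic floor in the TRACIAL half-filled ground state `ω = tr(P ·)/tr P`) and of
`HubbardFerrimagneticOrder` (the floor for the `S^z = 0` member). HONEST FRAMING: finite volume,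
bipartite hopping (`t' = 0`), `t ≠ 0`, `U > 0`, half filling `N = |Λ|`, `|Λ|` of either parity,
no balance hypothesis; non-strict inequalities.

Tasaki's Theorem 5.3 speaks of "the ground-state expectation"; when `|A| ≠ |Aᶜ|` the half-filled
ground states form Lieb's `(2S₀+1)`-fold spin multiplet, `S₀ = ||A| - |Aᶜ||/2`, and for an `SU(2)`
SCALAR observable `O` (`[O, S^±] = 0`: `𝐒_x·𝐒_y`, the staggered structure factor `𝓢_A`, …) the
expectation does not depend on the member. This file proves that statement from what the tree has —
WITHOUT Wigner–Eckart theory and without Lieb's `S²` theorem — by a weight argument on the sector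
decomposition `V = ⊕_a V_a`, `V_a = V ∩ {(N↑, N↓) = (a, N - a)}` of the half-filled ground space:

* `dim V_a ≤ 1` (`groundState_sector_unique`: Lieb's per-sector uniqueness
  `LiebTwo.halfFilled_upDownSector_groundState` + `hamiltonian_mulVec_sectorProj_eq_sectorEnergy`);
* the cross-multiplied Wigner–Eckart step (`expect_spinMinus_mul_normSq`): for `u ∈ V_a` and
  `[O, S⁺] = 0`, `⟨S⁻u, O S⁻u⟩ ‖u‖² = ⟨u, O u⟩ ‖S⁻u‖²` (`S⁺S⁻u ∈ V_a = ℂu`); dually with `S⁺`;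
* weights: `S⁻u = 0`, `u ∈ V_a ∖ 0` forces `2a ≤ N` and `S⁺u = 0` forces `N ≤ 2a`
  (`LiebThm1.eq_zero_of_spinMinus_mulVec_eq_zero`), so every nonzero `V_a` is linked to the anchor
  sector `a₀ = ⌊N/2⌋` through nonzero sectors (`exists_anchor_of_groundState_sector`), along which
  the ratio `⟨u, O u⟩/‖u‖²` is constant;
* hence **`groundState_expect_mul_normSq_eq`**: `⟨ψ, O ψ⟩ ‖φ‖² = ⟨φ, O φ⟩ ‖ψ‖²` for ALL half-filled
  ground states `ψ, φ` and every sector-preserving `O` with `[O, S⁺] = [O, S⁻] = 0`, and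
  **`projState_mul_normSq_eq_expect`**: `ω(O) ‖ψ‖² = ⟨ψ, O ψ⟩` (the tracial value IS the member
  value).

Consequences, member by member (Shen–Qiu–Tian 1994 = Tasaki 1998 Thm. 5.3, non-strict; Lieb 1989
Thm. 2 / Tasaki §5.3 ferrimagnetism):
* `fermionSpinDot_commute_spinPlus/Minus`, `stagSpinStructure_commute_spinPlus/Minus` (`𝐒_x·𝐒_y`
  and `𝓢_A` are `SU(2)` scalars), `preservesSectors_fermionSpinDot`,
  `preservesSectors_stagSpinStructure`;
* **`groundState_sign_rule_spinDot`**: `ε_x ε_y Re⟨ψ, 𝐒_x·𝐒_y ψ⟩ ≥ 0` for EVERY half-filled ground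
  state `ψ`; `groundState_fermionSpinDot_nonneg_of_same`, `_nonpos_of_opposite`, `_nonpos_of_adj`;
* **`groundState_liebSpin_le_re_expect_stagSpinStructure`** (`|Λ|` even):
  `Re⟨ψ, 𝓢_A ψ⟩ ≥ S₀(S₀+1)‖ψ‖² ≥ ¼(|A| - |Aᶜ|)²‖ψ‖²` for EVERY half-filled ground state — the
  `TODO(general member)` of `HubbardFerrimagneticOrder`.

## References
* H. Tasaki, *The Hubbard model — an introduction and selected rigorous results*, J. Phys.:
  Condens. Matter 10 (1998) 4353, Theorem 5.3 and §5.3. [Tasaki1998]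
* S.-Q. Shen, Z.-M. Qiu, G.-S. Tian, Phys. Rev. Lett. 72 (1994) 1280–1282, Theorem and
  eqs. (7)–(9). [ShenQiuTian1994]
* E. H. Lieb, *Two theorems on the Hubbard model*, Phys. Rev. Lett. 62 (1989) 1201, Theorem 2 and
  its proof (uniqueness in every `S^z` sector). [LiebPRL1989]
* H. Tasaki, *Physics and Mathematics of Quantum Many-Body Systems* (2020), §2.1 (symmetry and
  ground-state expectations), App. A.3 (`SU(2)` multiplets). [Tasaki2020]
* F. H. L. Essler et al., *The One-Dimensional Hubbard Model* (2005), §2.2.5. [EsslerEtAl2005]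
-/

noncomputable section

namespace Literature.MathematicalPhysics.QuantumLattice

open Matrix Finset LiebThm1 LiebTwo FermionSpinMoment
open scoped ComplexOrder

/-! ### `𝐒_x·𝐒_y` and `𝓢_A` are `SU(2)` scalars and conserve `(N↑, N↓)` -/

section Scalars

variable {Λ : Type*} [LinearOrder Λ] [Fintype Λ]

/-- `[S⁺_x, S⁺] = 0` (`[c†_{x↑}c_{x↓}, c†_{z↑}c_{z↓}] = 0`: the Kronecker deltas of the bilinear
commutator pair opposite spins). [cite: EsslerEtAl2005, §2.2.5 eqs. (2.71)–(2.73)] -/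
theorem fermionSpinPlus_commute_spinPlus (x : Λ) :
    fermionSpinPlus x * spinPlus = spinPlus * fermionSpinPlus x := by
  rw [← sub_eq_zero, ← sum_fermionSpinPlus, Finset.mul_sum, Finset.sum_mul,
    ← Finset.sum_sub_distrib]
  refine Finset.sum_eq_zero fun z _ => ?_
  rw [fermionSpinPlus, fermionSpinPlus, LiebThm1.creation_mul_annihilation_commutator]
  simp

/-- `[S⁻_x, S⁻] = 0` (adjoint of `[S⁺_x, S⁺] = 0`).
[cite: EsslerEtAl2005, §2.2.5 eqs. (2.71)–(2.73)] -/
theorem fermionSpinMinus_commute_spinMinus (x : Λ) :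
    fermionSpinMinus x * spinMinus = spinMinus * fermionSpinMinus x := by
  have h := congrArg conjTranspose (fermionSpinPlus_commute_spinPlus x)
  rw [conjTranspose_mul, conjTranspose_mul, conjTranspose_fermionSpinPlus] at h
  have hm : (spinPlus : Matrix (Finset (Orb Λ)) (Finset (Orb Λ)) ℂ)ᴴ = spinMinus := rfl
  rw [hm] at h
  exact h.symm

/-- **`𝐒_x·𝐒_y` is an `SU(2)` scalar**: `[𝐒_x·𝐒_y, S⁺] = 0`
(`[S⁻_w, S⁺] = -2S^z_w`, `[S^z_w, S⁺] = S⁺_w`, `[S⁺_w, S⁺] = 0`).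
[cite: EsslerEtAl2005, §2.2.5 eqs. (2.71)–(2.73)] [cite: Tasaki2020, §2.1] -/
theorem fermionSpinDot_commute_spinPlus (x y : Λ) :
    fermionSpinDot x y * spinPlus = spinPlus * fermionSpinDot x y := by
  have hPx := fermionSpinPlus_commute_spinPlus x
  have hPy := fermionSpinPlus_commute_spinPlus y
  have hMx : fermionSpinMinus x * spinPlus =
      spinPlus * fermionSpinMinus x - (2 : ℂ) • fermionSpinZ x := by
    have h := fermionSpinMinus_mul_spinPlus_sub x
    rw [sub_eq_iff_eq_add] at h
    rw [h]; abel
  have hMy : fermionSpinMinus y * spinPlus =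
      spinPlus * fermionSpinMinus y - (2 : ℂ) • fermionSpinZ y := by
    have h := fermionSpinMinus_mul_spinPlus_sub y
    rw [sub_eq_iff_eq_add] at h
    rw [h]; abel
  have hZx : fermionSpinZ x * spinPlus = spinPlus * fermionSpinZ x + fermionSpinPlus x := by
    rw [← fermionSpinZ_mul_spinPlus_sub x]; abel
  have hZy : fermionSpinZ y * spinPlus = spinPlus * fermionSpinZ y + fermionSpinPlus y := by
    rw [← fermionSpinZ_mul_spinPlus_sub y]; abel
  -- push `S⁺` through the right factors, then through the left factors
  have h1 : fermionSpinPlus x * fermionSpinMinus y * spinPlus =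
      spinPlus * (fermionSpinPlus x * fermionSpinMinus y) -
        (2 : ℂ) • (fermionSpinPlus x * fermionSpinZ y) := by
    rw [Matrix.mul_assoc, hMy, Matrix.mul_sub, ← Matrix.mul_assoc, hPx, Matrix.mul_assoc,
      Matrix.mul_smul]
  have h2 : fermionSpinMinus x * fermionSpinPlus y * spinPlus =
      spinPlus * (fermionSpinMinus x * fermionSpinPlus y) -
        (2 : ℂ) • (fermionSpinZ x * fermionSpinPlus y) := by
    rw [Matrix.mul_assoc, hPy, ← Matrix.mul_assoc, hMx, Matrix.sub_mul, Matrix.smul_mul,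
      Matrix.mul_assoc]
  have h3 : fermionSpinZ x * fermionSpinZ y * spinPlus =
      spinPlus * (fermionSpinZ x * fermionSpinZ y) + fermionSpinPlus x * fermionSpinZ y +
        fermionSpinZ x * fermionSpinPlus y := by
    rw [Matrix.mul_assoc, hZy, Matrix.mul_add, ← Matrix.mul_assoc, hZx, Matrix.add_mul,
      Matrix.mul_assoc]
  rw [fermionSpinDot_def, Matrix.add_mul, Matrix.smul_mul, Matrix.add_mul, h1, h2, h3,
    Matrix.mul_add, Matrix.mul_smul, Matrix.mul_add]
  simp only [smul_add, smul_sub, smul_smul, show (1 / 2 : ℂ) * 2 = 1 by norm_num, one_smul]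
  all_goals abel

/-- `[𝐒_x·𝐒_y, S⁻] = 0` (adjoint of `[𝐒_y·𝐒_x, S⁺] = 0`).
[cite: EsslerEtAl2005, §2.2.5 eqs. (2.71)–(2.73)] [cite: Tasaki2020, §2.1] -/
theorem fermionSpinDot_commute_spinMinus (x y : Λ) :
    fermionSpinDot x y * spinMinus = spinMinus * fermionSpinDot x y := by
  have h := congrArg conjTranspose (fermionSpinDot_commute_spinPlus y x)
  rw [conjTranspose_mul, conjTranspose_mul, conjTranspose_fermionSpinDot] at h
  have hm : (spinPlus : Matrix (Finset (Orb Λ)) (Finset (Orb Λ)) ℂ)ᴴ = spinMinus := rfl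
  rw [hm] at h
  exact h.symm

/-- Differences of sector-preserving matrices preserve sectors. [folklore] -/
private theorem multipletAux_preservesSectors_sub
    {M M' : Matrix (Finset (Orb Λ)) (Finset (Orb Λ)) ℂ}
    (hM : PreservesSectors M) (hM' : PreservesSectors M') : PreservesSectors (M - M') := by
  intro s s' h
  rw [Matrix.sub_apply] at h
  by_cases hMs : M s s' = 0
  · rw [hMs, zero_sub, neg_ne_zero] at h
    exact hM' s s' h
  · exact hM s s' hMs

/-- `S^z_x` conserves `(N↑, N↓)` (it is diagonal). [cite: LiebPRL1989, Remark (2)] -/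
theorem preservesSectors_fermionSpinZ (x : Λ) : PreservesSectors (fermionSpinZ x) := by
  rw [fermionSpinZ_def]
  exact (multipletAux_preservesSectors_sub (preservesSectors_numberOp x 0)
    (preservesSectors_numberOp x 1)).smul _

/-- A product (spin-lowering matrix) · (spin-raising matrix) conserves `(N↑, N↓)`. [folklore] -/
private theorem multipletAux_preservesSectors_mul_of_lowers_raises
    {M P : Matrix (Finset (Orb Λ)) (Finset (Orb Λ)) ℂ}
    (hM : LowersSpin M) (hP : RaisesSpin P) : PreservesSectors (M * P) := by
  intro s s' h
  rw [Matrix.mul_apply] at h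
  obtain ⟨u, -, hu⟩ := Finset.exists_ne_zero_of_sum_ne_zero h
  have h1 := hM s u (left_ne_zero_of_mul hu)
  have h2 := hP u s' (right_ne_zero_of_mul hu)
  omega

/-- `S⁻_x S⁺_y` conserves `(N↑, N↓)`. [cite: LiebPRL1989, eq. (2)] -/
theorem preservesSectors_fermionSpinMinus_mul_fermionSpinPlus (x y : Λ) :
    PreservesSectors (fermionSpinMinus x * fermionSpinPlus y) := by
  have hx : LowersSpin (fermionSpinMinus x) := by
    rw [← conjTranspose_fermionSpinPlus]
    exact (raisesSpin_flip x).conjTranspose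
  exact multipletAux_preservesSectors_mul_of_lowers_raises hx (raisesSpin_flip y)

/-- **`𝐒_x·𝐒_y` conserves `(N↑, N↓)`.** [cite: LiebPRL1989, Remark (2)] -/
theorem preservesSectors_fermionSpinDot (x y : Λ) : PreservesSectors (fermionSpinDot x y) := by
  rw [fermionSpinDot_def]
  exact (((preservesSectors_fermionSpinPlus_mul_fermionSpinMinus x y).add
    (preservesSectors_fermionSpinMinus_mul_fermionSpinPlus x y)).smul _).add
    ((preservesSectors_fermionSpinZ x).mul (preservesSectors_fermionSpinZ y))

/-- `𝓢_A = Σ ε_x ε_y 𝐒_x·𝐒_y` conserves `(N↑, N↓)`. [cite: LiebPRL1989, Theorem 2] -/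
theorem preservesSectors_stagSpinStructure (A : Finset Λ) :
    PreservesSectors (stagSpinStructure A) :=
  PreservesSectors.sum fun x _ => PreservesSectors.sum fun y _ =>
    (preservesSectors_fermionSpinDot x y).smul _

/-- **`𝓢_A` is an `SU(2)` scalar**: `[𝓢_A, S⁺] = 0`. [cite: Tasaki2020, §2.1] -/
theorem stagSpinStructure_commute_spinPlus (A : Finset Λ) :
    stagSpinStructure A * spinPlus = spinPlus * stagSpinStructure A := by
  rw [stagSpinStructure, Finset.sum_mul, Finset.mul_sum]
  refine Finset.sum_congr rfl fun x _ => ?_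
  rw [Finset.sum_mul, Finset.mul_sum]
  refine Finset.sum_congr rfl fun y _ => ?_
  rw [Matrix.smul_mul, Matrix.mul_smul, fermionSpinDot_commute_spinPlus]

/-- `[𝓢_A, S⁻] = 0`. [cite: Tasaki2020, §2.1] -/
theorem stagSpinStructure_commute_spinMinus (A : Finset Λ) :
    stagSpinStructure A * spinMinus = spinMinus * stagSpinStructure A := by
  rw [stagSpinStructure, Finset.sum_mul, Finset.mul_sum]
  refine Finset.sum_congr rfl fun x _ => ?_
  rw [Finset.sum_mul, Finset.mul_sum]
  refine Finset.sum_congr rfl fun y _ => ?_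
  rw [Matrix.smul_mul, Matrix.mul_smul, fermionSpinDot_commute_spinMinus]

end Scalars

/-! ### The half-filled ground multiplet, sector by sector -/

section Multiplet

variable {Λ : Type*} [LinearOrder Λ] [Fintype Λ] {G : SimpleGraph Λ} [DecidableRel G.Adj]

/-- `S⁻` maps half-filled ground states to ground states or to `0` (`[H, S⁻] = [N, S⁻] = 0`).
[cite: LiebPRL1989, proof of Theorem 1] -/
theorem isGroundState_spinMinus_mulVec {t U : ℝ} {N : ℕ} {ψ : Fock (Orb Λ)}
    (hψ : IsGroundState (hamiltonian G t U) N ψ) (h0 : spinMinus *ᵥ ψ ≠ 0) :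
    IsGroundState (hamiltonian G t U) N (spinMinus *ᵥ ψ) := by
  refine ⟨isNParticle_mulVec_of_commute hψ.1 totalNumber_mul_spinMinus, h0, ?_⟩
  rw [mulVec_mulVec, (hamiltonian_commute_spinMinus G t U).eq, ← mulVec_mulVec, hψ.2.2,
    mulVec_smul]

/-- `S⁺` maps half-filled ground states to ground states or to `0`.
[cite: LiebPRL1989, proof of Theorem 1] -/
theorem isGroundState_spinPlus_mulVec {t U : ℝ} {N : ℕ} {ψ : Fock (Orb Λ)}
    (hψ : IsGroundState (hamiltonian G t U) N ψ) (h0 : spinPlus *ᵥ ψ ≠ 0) :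
    IsGroundState (hamiltonian G t U) N (spinPlus *ᵥ ψ) := by
  refine ⟨isNParticle_mulVec_of_commute hψ.1 totalNumber_mul_spinPlus, h0, ?_⟩
  rw [mulVec_mulVec, (hamiltonian_commute_spinPlus G t U).eq, ← mulVec_mulVec, hψ.2.2,
    mulVec_smul]

/-- The sector components `Π_{a, N-a} ψ` of a ground state are ground states or `0`
(`[H, Π_{ab}] = 0`). [cite: LiebPRL1989, proof of Theorem 1] -/
theorem isGroundState_sectorProj {t U : ℝ} {N : ℕ} {ψ : Fock (Orb Λ)}
    (hψ : IsGroundState (hamiltonian G t U) N ψ) {a b : ℕ} (hab : a + b = N)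
    (h0 : sectorProj a b ψ ≠ 0) : IsGroundState (hamiltonian G t U) N (sectorProj a b ψ) := by
  refine ⟨?_, h0, ?_⟩
  · rw [← hab]; exact (isInSector_sectorProj a b ψ).isNParticle
  · rw [(preservesSectors_hamiltonian G t U).mulVec_sectorProj, hψ.2.2, sectorProj_smul]

/-- **Lieb's uniqueness, sector by sector: `dim V_a ≤ 1`.** On a connected bipartite graph, `t ≠ 0`,
`U > 0`: two half-filled ground states in the same sector `(N↑, N↓) = (a, b)` are proportional.
[cite: LiebPRL1989, Theorems 1 and 2 (proof)] -/
theorem groundState_sector_unique (hG : G.Connected) (A : Finset Λ)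
    (hA : ∀ x y : Λ, G.Adj x y → (x ∈ A ↔ y ∉ A)) {t U : ℝ} (ht : t ≠ 0) (hU : 0 < U)
    {a b : ℕ} (hab : a + b = Fintype.card Λ) {ψ φ : Fock (Orb Λ)}
    (hψ : IsGroundState (hamiltonian G t U) (Fintype.card Λ) ψ) (hψs : IsInSector a b ψ)
    (hφ : IsGroundState (hamiltonian G t U) (Fintype.card Λ) φ) (hφs : IsInSector a b φ) :
    ∃ c : ℂ, φ = c • ψ := by
  obtain ⟨W₀, -, -, -, huniq⟩ := halfFilled_upDownSector_groundState G hG A hA ht hU hab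
  have hHψ := hamiltonian_mulVec_sectorProj_eq_sectorEnergy G hψ.2.2 hab
  rw [sectorProj_eq_self hψs] at hHψ
  have hHφ := hamiltonian_mulVec_sectorProj_eq_sectorEnergy G hφ.2.2 hab
  rw [sectorProj_eq_self hφs] at hHφ
  obtain ⟨c₁, hc₁⟩ := huniq ψ hψs hHψ
  obtain ⟨c₂, hc₂⟩ := huniq φ hφs hHφ
  have hc₁0 : c₁ ≠ 0 := by
    rintro rfl
    exact hψ.2.1 (by rw [hc₁, zero_smul])
  refine ⟨c₂ / c₁, ?_⟩
  rw [hc₂, hc₁, smul_smul, div_mul_cancel₀ _ hc₁0]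

omit [LinearOrder Λ] in
/-- Scaling a vector scales `⟨ψ, O ψ⟩` and `‖ψ‖²` alike:
`⟨ψ, O ψ⟩ ‖cψ‖² = ⟨cψ, O cψ⟩ ‖ψ‖²`. [folklore] -/
private theorem multipletAux_rel_smul (O : Matrix (Finset (Orb Λ)) (Finset (Orb Λ)) ℂ)
    (ψ : Fock (Orb Λ)) (c : ℂ) :
    star ψ ⬝ᵥ (O *ᵥ ψ) * (star (c • ψ) ⬝ᵥ (c • ψ)) =
      star (c • ψ) ⬝ᵥ (O *ᵥ (c • ψ)) * (star ψ ⬝ᵥ ψ) := by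
  rw [mulVec_smul, star_smul, smul_dotProduct, dotProduct_smul, smul_dotProduct, dotProduct_smul,
    smul_eq_mul, smul_eq_mul, smul_eq_mul, smul_eq_mul]
  ring

omit [LinearOrder Λ] in
/-- Transitivity of the ratio relation through a nonzero middle vector. [folklore] -/
private theorem multipletAux_rel_trans {O : Matrix (Finset (Orb Λ)) (Finset (Orb Λ)) ℂ}
    {u v w : Fock (Orb Λ)}
    (h1 : star u ⬝ᵥ (O *ᵥ u) * (star v ⬝ᵥ v) = star v ⬝ᵥ (O *ᵥ v) * (star u ⬝ᵥ u))
    (h2 : star v ⬝ᵥ (O *ᵥ v) * (star w ⬝ᵥ w) = star w ⬝ᵥ (O *ᵥ w) * (star v ⬝ᵥ v))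
    (hv : v ≠ 0) :
    star u ⬝ᵥ (O *ᵥ u) * (star w ⬝ᵥ w) = star w ⬝ᵥ (O *ᵥ w) * (star u ⬝ᵥ u) := by
  have hnv : star v ⬝ᵥ v ≠ 0 := fun h => hv ((star_dotProduct_self_eq_zero_iff v).1 h)
  refine mul_right_cancel₀ hnv ?_
  linear_combination (star w ⬝ᵥ w) * h1 + (star u ⬝ᵥ u) * h2

/-- **The Wigner–Eckart step, downwards.** For a half-filled ground state `u` in the sector
`(a, b)` and an `O` with `O S⁺ = S⁺ O`: `⟨S⁻u, O S⁻u⟩ ‖u‖² = ⟨u, O u⟩ ‖S⁻u‖²`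
(`⟨S⁻u, O S⁻u⟩ = ⟨u, O S⁺S⁻ u⟩` and `S⁺S⁻u ∈ V_a = ℂ u`). [cite: Tasaki2020, §2.1 and App. A.3]
[cite: LiebPRL1989, proof of Theorem 2] -/
theorem expect_spinMinus_mul_normSq (hG : G.Connected) (A : Finset Λ)
    (hA : ∀ x y : Λ, G.Adj x y → (x ∈ A ↔ y ∉ A)) {t U : ℝ} (ht : t ≠ 0) (hU : 0 < U)
    {O : Matrix (Finset (Orb Λ)) (Finset (Orb Λ)) ℂ} (hO : O * spinPlus = spinPlus * O)
    {a b : ℕ} (hab : a + b = Fintype.card Λ) {u : Fock (Orb Λ)}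
    (hu : IsGroundState (hamiltonian G t U) (Fintype.card Λ) u) (hus : IsInSector a b u) :
    star (spinMinus *ᵥ u) ⬝ᵥ (O *ᵥ (spinMinus *ᵥ u)) * (star u ⬝ᵥ u) =
      star u ⬝ᵥ (O *ᵥ u) * (star (spinMinus *ᵥ u) ⬝ᵥ (spinMinus *ᵥ u)) := by
  have hSm : (spinMinus : Matrix (Finset (Orb Λ)) (Finset (Orb Λ)) ℂ)ᴴ = spinPlus := by
    rw [spinMinus, conjTranspose_conjTranspose]
  -- `S⁺S⁻u = c u`
  obtain ⟨c, hc⟩ : ∃ c : ℂ, spinPlus *ᵥ (spinMinus *ᵥ u) = c • u := by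
    cases a with
    | zero =>
      refine ⟨0, ?_⟩
      rw [lowersSpin_spinMinus.mulVec_eq_zero hus, mulVec_zero, zero_smul]
    | succ a' =>
      have hs1 : IsInSector a' (b + 1) (spinMinus *ᵥ u) :=
        lowersSpin_spinMinus.isInSector_mulVec hus
      have hs2 : IsInSector (a' + 1) b (spinPlus *ᵥ (spinMinus *ᵥ u)) :=
        raisesSpin_spinPlus.isInSector_mulVec hs1
      by_cases h0 : spinPlus *ᵥ (spinMinus *ᵥ u) = 0
      · exact ⟨0, by rw [h0, zero_smul]⟩
      · have hm0 : spinMinus *ᵥ u ≠ 0 := by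
          intro h; exact h0 (by rw [h, mulVec_zero])
        exact groundState_sector_unique hG A hA ht hU hab hu hus
          (isGroundState_spinPlus_mulVec (isGroundState_spinMinus_mulVec hu hm0) h0) hs2
  have hE : star (spinMinus *ᵥ u) ⬝ᵥ (O *ᵥ (spinMinus *ᵥ u)) = c * (star u ⬝ᵥ (O *ᵥ u)) := by
    rw [star_mulVec, ← dotProduct_mulVec, hSm, mulVec_mulVec, ← hO, ← mulVec_mulVec, hc,
      mulVec_smul, dotProduct_smul, smul_eq_mul]
  have hn : star (spinMinus *ᵥ u) ⬝ᵥ (spinMinus *ᵥ u) = c * (star u ⬝ᵥ u) := by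
    rw [star_mulVec, ← dotProduct_mulVec, hSm, hc, dotProduct_smul, smul_eq_mul]
  rw [hE, hn]
  ring

/-- **The Wigner–Eckart step, upwards**: `⟨S⁺u, O S⁺u⟩ ‖u‖² = ⟨u, O u⟩ ‖S⁺u‖²` for `O S⁻ = S⁻ O`.
[cite: Tasaki2020, §2.1 and App. A.3] [cite: LiebPRL1989, proof of Theorem 2] -/
theorem expect_spinPlus_mul_normSq (hG : G.Connected) (A : Finset Λ)
    (hA : ∀ x y : Λ, G.Adj x y → (x ∈ A ↔ y ∉ A)) {t U : ℝ} (ht : t ≠ 0) (hU : 0 < U)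
    {O : Matrix (Finset (Orb Λ)) (Finset (Orb Λ)) ℂ} (hO : O * spinMinus = spinMinus * O)
    {a b : ℕ} (hab : a + b = Fintype.card Λ) {u : Fock (Orb Λ)}
    (hu : IsGroundState (hamiltonian G t U) (Fintype.card Λ) u) (hus : IsInSector a b u) :
    star (spinPlus *ᵥ u) ⬝ᵥ (O *ᵥ (spinPlus *ᵥ u)) * (star u ⬝ᵥ u) =
      star u ⬝ᵥ (O *ᵥ u) * (star (spinPlus *ᵥ u) ⬝ᵥ (spinPlus *ᵥ u)) := by
  have hSp : (spinPlus : Matrix (Finset (Orb Λ)) (Finset (Orb Λ)) ℂ)ᴴ = spinMinus := rfl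
  obtain ⟨c, hc⟩ : ∃ c : ℂ, spinMinus *ᵥ (spinPlus *ᵥ u) = c • u := by
    cases b with
    | zero =>
      refine ⟨0, ?_⟩
      rw [raisesSpin_spinPlus.mulVec_eq_zero hus, mulVec_zero, zero_smul]
    | succ b' =>
      have hs1 : IsInSector (a + 1) b' (spinPlus *ᵥ u) := raisesSpin_spinPlus.isInSector_mulVec hus
      have hs2 : IsInSector a (b' + 1) (spinMinus *ᵥ (spinPlus *ᵥ u)) :=
        lowersSpin_spinMinus.isInSector_mulVec hs1
      by_cases h0 : spinMinus *ᵥ (spinPlus *ᵥ u) = 0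
      · exact ⟨0, by rw [h0, zero_smul]⟩
      · have hp0 : spinPlus *ᵥ u ≠ 0 := by
          intro h; exact h0 (by rw [h, mulVec_zero])
        exact groundState_sector_unique hG A hA ht hU hab hu hus
          (isGroundState_spinMinus_mulVec (isGroundState_spinPlus_mulVec hu hp0) h0) hs2
  have hE : star (spinPlus *ᵥ u) ⬝ᵥ (O *ᵥ (spinPlus *ᵥ u)) = c * (star u ⬝ᵥ (O *ᵥ u)) := by
    rw [star_mulVec, ← dotProduct_mulVec, hSp, mulVec_mulVec, ← hO, ← mulVec_mulVec, hc,
      mulVec_smul, dotProduct_smul, smul_eq_mul]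
  have hn : star (spinPlus *ᵥ u) ⬝ᵥ (spinPlus *ᵥ u) = c * (star u ⬝ᵥ u) := by
    rw [star_mulVec, ← dotProduct_mulVec, hSp, hc, dotProduct_smul, smul_eq_mul]
  rw [hE, hn]
  ring

/-- Walking DOWN to the anchor sector `a₀ = ⌊N/2⌋`: a ground state in the sector `(a₀ + k, b)`
is linked to a ground state in the sector `(a₀, N - a₀)` with the same ratio `⟨·, O ·⟩/‖·‖²`
(`S⁻u ≠ 0` as long as `N↑ > N↓`, `LiebThm1.eq_zero_of_spinMinus_mulVec_eq_zero`).
[cite: LiebPRL1989, proof of Theorem 1] [cite: Tasaki2020, App. A.3] -/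
private theorem multipletAux_anchor_down (hG : G.Connected) (A : Finset Λ)
    (hA : ∀ x y : Λ, G.Adj x y → (x ∈ A ↔ y ∉ A)) {t U : ℝ} (ht : t ≠ 0) (hU : 0 < U)
    {O : Matrix (Finset (Orb Λ)) (Finset (Orb Λ)) ℂ} (hO : O * spinPlus = spinPlus * O) (k : ℕ) :
    ∀ {a b : ℕ} {u : Fock (Orb Λ)}, a + b = Fintype.card Λ → a = Fintype.card Λ / 2 + k →
      IsGroundState (hamiltonian G t U) (Fintype.card Λ) u → IsInSector a b u →
      ∃ w : Fock (Orb Λ), IsGroundState (hamiltonian G t U) (Fintype.card Λ) w ∧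
        IsInSector (Fintype.card Λ / 2) (Fintype.card Λ - Fintype.card Λ / 2) w ∧
        star u ⬝ᵥ (O *ᵥ u) * (star w ⬝ᵥ w) = star w ⬝ᵥ (O *ᵥ w) * (star u ⬝ᵥ u) := by
  induction k with
  | zero =>
    intro a b u hab ha hu hus
    rw [Nat.add_zero] at ha
    subst ha
    obtain rfl : b = Fintype.card Λ - Fintype.card Λ / 2 := by omega
    exact ⟨u, hu, hus, rfl⟩
  | succ k ih =>
    intro a b u hab ha hu hus
    have hba : b < a := by omega
    obtain ⟨a', rfl⟩ : ∃ a', a = a' + 1 := ⟨a - 1, by omega⟩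
    have hm0 : spinMinus *ᵥ u ≠ 0 := fun h =>
      hu.2.1 (eq_zero_of_spinMinus_mulVec_eq_zero hba hus h)
    have hmu := isGroundState_spinMinus_mulVec hu hm0
    have hms : IsInSector a' (b + 1) (spinMinus *ᵥ u) := lowersSpin_spinMinus.isInSector_mulVec hus
    obtain ⟨w, hw, hws, hrel⟩ := ih (by omega) (by omega) hmu hms
    refine ⟨w, hw, hws, multipletAux_rel_trans ?_ hrel hm0⟩
    exact (expect_spinMinus_mul_normSq hG A hA ht hU hO hab hu hus).symm

/-- Walking UP to the anchor sector: a ground state in the sector `(a₀ - k, b)` is linked to a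
ground state in the sector `(a₀, N - a₀)` with the same ratio (`S⁺u ≠ 0` as long as `N↑ < N↓`).
[cite: LiebPRL1989, proof of Theorem 1] [cite: Tasaki2020, App. A.3] -/
private theorem multipletAux_anchor_up (hG : G.Connected) (A : Finset Λ)
    (hA : ∀ x y : Λ, G.Adj x y → (x ∈ A ↔ y ∉ A)) {t U : ℝ} (ht : t ≠ 0) (hU : 0 < U)
    {O : Matrix (Finset (Orb Λ)) (Finset (Orb Λ)) ℂ} (hO : O * spinMinus = spinMinus * O) (k : ℕ) :
    ∀ {a b : ℕ} {u : Fock (Orb Λ)}, a + b = Fintype.card Λ → a + k = Fintype.card Λ / 2 →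
      IsGroundState (hamiltonian G t U) (Fintype.card Λ) u → IsInSector a b u →
      ∃ w : Fock (Orb Λ), IsGroundState (hamiltonian G t U) (Fintype.card Λ) w ∧
        IsInSector (Fintype.card Λ / 2) (Fintype.card Λ - Fintype.card Λ / 2) w ∧
        star u ⬝ᵥ (O *ᵥ u) * (star w ⬝ᵥ w) = star w ⬝ᵥ (O *ᵥ w) * (star u ⬝ᵥ u) := by
  induction k with
  | zero =>
    intro a b u hab ha hu hus
    rw [Nat.add_zero] at ha
    subst ha
    obtain rfl : b = Fintype.card Λ - Fintype.card Λ / 2 := by omega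
    exact ⟨u, hu, hus, rfl⟩
  | succ k ih =>
    intro a b u hab ha hu hus
    have hab' : a < b := by omega
    obtain ⟨b', rfl⟩ : ∃ b', b = b' + 1 := ⟨b - 1, by omega⟩
    have hp0 : spinPlus *ᵥ u ≠ 0 := fun h =>
      hu.2.1 (eq_zero_of_spinPlus_mulVec_eq_zero hab' hus h)
    have hpu := isGroundState_spinPlus_mulVec hu hp0
    have hps : IsInSector (a + 1) b' (spinPlus *ᵥ u) := raisesSpin_spinPlus.isInSector_mulVec hus
    obtain ⟨w, hw, hws, hrel⟩ := ih (by omega) (by omega) hpu hps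
    refine ⟨w, hw, hws, multipletAux_rel_trans ?_ hrel hp0⟩
    exact (expect_spinPlus_mul_normSq hG A hA ht hU hO hab hu hus).symm

/-- **Every nonzero sector of the ground multiplet is linked to the anchor sector** `a₀ = ⌊N/2⌋`:
for a half-filled ground state `u` in the sector `(a, b)` there is a ground state `w` in the
sector `(a₀, N - a₀)` with `⟨u, O u⟩ ‖w‖² = ⟨w, O w⟩ ‖u‖²`. [cite: Tasaki2020, App. A.3]
[cite: LiebPRL1989, proof of Theorem 1] -/
theorem exists_anchor_of_groundState_sector (hG : G.Connected) (A : Finset Λ)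
    (hA : ∀ x y : Λ, G.Adj x y → (x ∈ A ↔ y ∉ A)) {t U : ℝ} (ht : t ≠ 0) (hU : 0 < U)
    {O : Matrix (Finset (Orb Λ)) (Finset (Orb Λ)) ℂ} (hOp : O * spinPlus = spinPlus * O)
    (hOm : O * spinMinus = spinMinus * O) {a b : ℕ} (hab : a + b = Fintype.card Λ)
    {u : Fock (Orb Λ)} (hu : IsGroundState (hamiltonian G t U) (Fintype.card Λ) u)
    (hus : IsInSector a b u) :
    ∃ w : Fock (Orb Λ), IsGroundState (hamiltonian G t U) (Fintype.card Λ) w ∧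
      IsInSector (Fintype.card Λ / 2) (Fintype.card Λ - Fintype.card Λ / 2) w ∧
      star u ⬝ᵥ (O *ᵥ u) * (star w ⬝ᵥ w) = star w ⬝ᵥ (O *ᵥ w) * (star u ⬝ᵥ u) := by
  by_cases h : Fintype.card Λ / 2 ≤ a
  · exact multipletAux_anchor_down hG A hA ht hU hOp (a - Fintype.card Λ / 2) hab (by omega) hu hus
  · exact multipletAux_anchor_up hG A hA ht hU hOm (Fintype.card Λ / 2 - a) hab (by omega) hu hus

/-- **Constancy of `SU(2)`-scalar expectations across the sectors of the ground multiplet**: for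
half-filled ground states `u`, `v` lying in (possibly different) `(N↑, N↓)` sectors and `O`
commuting with `S⁺` and `S⁻`, `⟨u, O u⟩ ‖v‖² = ⟨v, O v⟩ ‖u‖²`. [cite: Tasaki2020, §2.1 and App. A.3]
[cite: Tasaki1998, Theorem 5.3] -/
theorem groundState_sector_expect_mul_normSq_eq (hG : G.Connected) (A : Finset Λ)
    (hA : ∀ x y : Λ, G.Adj x y → (x ∈ A ↔ y ∉ A)) {t U : ℝ} (ht : t ≠ 0) (hU : 0 < U)
    {O : Matrix (Finset (Orb Λ)) (Finset (Orb Λ)) ℂ} (hOp : O * spinPlus = spinPlus * O)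
    (hOm : O * spinMinus = spinMinus * O) {a b a' b' : ℕ} (hab : a + b = Fintype.card Λ)
    (hab' : a' + b' = Fintype.card Λ) {u v : Fock (Orb Λ)}
    (hu : IsGroundState (hamiltonian G t U) (Fintype.card Λ) u) (hus : IsInSector a b u)
    (hv : IsGroundState (hamiltonian G t U) (Fintype.card Λ) v) (hvs : IsInSector a' b' v) :
    star u ⬝ᵥ (O *ᵥ u) * (star v ⬝ᵥ v) = star v ⬝ᵥ (O *ᵥ v) * (star u ⬝ᵥ u) := by
  obtain ⟨w, hw, hws, hrel⟩ := exists_anchor_of_groundState_sector hG A hA ht hU hOp hOm hab hu hus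
  obtain ⟨w', hw', hws', hrel'⟩ :=
    exists_anchor_of_groundState_sector hG A hA ht hU hOp hOm hab' hv hvs
  obtain ⟨c, rfl⟩ := groundState_sector_unique hG A hA ht hU (by omega) hw hws hw' hws'
  have hww' := multipletAux_rel_smul O w c
  exact multipletAux_rel_trans (multipletAux_rel_trans hrel hww' hw.2.1) hrel'.symm hw'.2.1

/-- A sector component of a ground state satisfies the ratio relation against any other one
(either it vanishes or it is a ground state of its sector). [cite: Tasaki2020, §2.1 and App. A.3] -/
private theorem multipletAux_rel_sectorProj (hG : G.Connected) (A : Finset Λ)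
    (hA : ∀ x y : Λ, G.Adj x y → (x ∈ A ↔ y ∉ A)) {t U : ℝ} (ht : t ≠ 0) (hU : 0 < U)
    {O : Matrix (Finset (Orb Λ)) (Finset (Orb Λ)) ℂ} (hOp : O * spinPlus = spinPlus * O)
    (hOm : O * spinMinus = spinMinus * O) {ψ φ : Fock (Orb Λ)}
    (hψ : IsGroundState (hamiltonian G t U) (Fintype.card Λ) ψ)
    (hφ : IsGroundState (hamiltonian G t U) (Fintype.card Λ) φ) {a a' : ℕ}
    (ha : a ≤ Fintype.card Λ) (ha' : a' ≤ Fintype.card Λ) :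
    star (sectorProj a (Fintype.card Λ - a) ψ) ⬝ᵥ (O *ᵥ sectorProj a (Fintype.card Λ - a) ψ) *
        (star (sectorProj a' (Fintype.card Λ - a') φ) ⬝ᵥ sectorProj a' (Fintype.card Λ - a') φ) =
      star (sectorProj a' (Fintype.card Λ - a') φ) ⬝ᵥ
          (O *ᵥ sectorProj a' (Fintype.card Λ - a') φ) *
        (star (sectorProj a (Fintype.card Λ - a) ψ) ⬝ᵥ sectorProj a (Fintype.card Λ - a) ψ) := by
  by_cases h1 : sectorProj a (Fintype.card Λ - a) ψ = 0
  · rw [h1, mulVec_zero, dotProduct_zero, zero_mul, mul_zero]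
  by_cases h2 : sectorProj a' (Fintype.card Λ - a') φ = 0
  · rw [h2, mulVec_zero, dotProduct_zero, zero_mul, mul_zero]
  exact groundState_sector_expect_mul_normSq_eq hG A hA ht hU hOp hOm (by omega) (by omega)
    (isGroundState_sectorProj hψ (by omega) h1) (isInSector_sectorProj _ _ _)
    (isGroundState_sectorProj hφ (by omega) h2) (isInSector_sectorProj _ _ _)

/-- `‖ψ‖² = Σ_a ‖Π_{a, N-a} ψ‖²` for an `N`-particle `ψ`. [cite: LiebPRL1989, proof of Theorem 1] -/
theorem normSq_eq_sum_normSq_sectorProj {N : ℕ} {ψ : Fock (Orb Λ)} (hN : IsNParticle N ψ) :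
    star ψ ⬝ᵥ ψ = ∑ a ∈ range (N + 1),
      star (sectorProj a (N - a) ψ) ⬝ᵥ sectorProj a (N - a) ψ := by
  have h1 : PreservesSectors (1 : Matrix (Finset (Orb Λ)) (Finset (Orb Λ)) ℂ) := by
    rw [← diagonal_one]; exact PreservesSectors.diagonal _
  have h := expect_eq_sum_expect_sectorProj h1 hN
  simpa only [one_mulVec] using h

/-- **`SU(2)`-scalar expectations do not depend on the member of the ground multiplet** (the
content of "the ground-state expectation" in Tasaki's Theorem 5.3 for degenerate ground states):
on a connected bipartite graph, `t ≠ 0`, `U > 0`, for every `O` conserving `(N↑, N↓)` with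
`[O, S⁺] = [O, S⁻] = 0` and all half-filled ground states `ψ, φ`:
`⟨ψ, O ψ⟩ ‖φ‖² = ⟨φ, O φ⟩ ‖ψ‖²`.
[cite: Tasaki1998, Theorem 5.3] [cite: Tasaki2020, §2.1 and App. A.3] -/
theorem groundState_expect_mul_normSq_eq (hG : G.Connected) (A : Finset Λ)
    (hA : ∀ x y : Λ, G.Adj x y → (x ∈ A ↔ y ∉ A)) {t U : ℝ} (ht : t ≠ 0) (hU : 0 < U)
    {O : Matrix (Finset (Orb Λ)) (Finset (Orb Λ)) ℂ} (hO : PreservesSectors O)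
    (hOp : O * spinPlus = spinPlus * O) (hOm : O * spinMinus = spinMinus * O) {ψ φ : Fock (Orb Λ)}
    (hψ : IsGroundState (hamiltonian G t U) (Fintype.card Λ) ψ)
    (hφ : IsGroundState (hamiltonian G t U) (Fintype.card Λ) φ) :
    star ψ ⬝ᵥ (O *ᵥ ψ) * (star φ ⬝ᵥ φ) = star φ ⬝ᵥ (O *ᵥ φ) * (star ψ ⬝ᵥ ψ) := by
  rw [expect_eq_sum_expect_sectorProj hO hψ.1, expect_eq_sum_expect_sectorProj hO hφ.1,
    normSq_eq_sum_normSq_sectorProj hψ.1, normSq_eq_sum_normSq_sectorProj hφ.1,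
    Finset.sum_mul_sum, Finset.sum_mul_sum, Finset.sum_comm]
  refine Finset.sum_congr rfl fun a' ha' => Finset.sum_congr rfl fun a ha => ?_
  exact multipletAux_rel_sectorProj hG A hA ht hU hOp hOm hψ hφ
    (Nat.lt_succ_iff.mp (Finset.mem_range.mp ha)) (Nat.lt_succ_iff.mp (Finset.mem_range.mp ha'))

/-- **The tracial ground-state value is the value in every member**: with `P` the projection onto
the half-filled ground multiplet and `ω = tr(P ·)/tr P`, `ω(O) ‖ψ‖² = ⟨ψ, O ψ⟩` for every
half-filled ground state `ψ` and every `(N↑, N↓)`-conserving `SU(2)` scalar `O` (expand `tr(P O)`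
over an orthonormal frame of ground states).
[cite: Tasaki2020, §2.1] [cite: Tasaki1998, Theorem 5.3] -/
theorem projState_mul_normSq_eq_expect (hG : G.Connected) (A : Finset Λ)
    (hA : ∀ x y : Λ, G.Adj x y → (x ∈ A ↔ y ∉ A)) {t U : ℝ} (ht : t ≠ 0) (hU : 0 < U)
    {O : Matrix (Finset (Orb Λ)) (Finset (Orb Λ)) ℂ} (hO : PreservesSectors O)
    (hOp : O * spinPlus = spinPlus * O) (hOm : O * spinMinus = spinMinus * O) {ψ : Fock (Orb Λ)}
    (hψ : IsGroundState (hamiltonian G t U) (Fintype.card Λ) ψ) :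
    ((hamiltonian G t U).sectorGroundProj
          (nParticleSubmodule (ι := Orb Λ) (Fintype.card Λ))).projState O * (star ψ ⬝ᵥ ψ) =
      star ψ ⬝ᵥ (O *ᵥ ψ) := by
  set H := hamiltonian G t U with hH
  set K : Submodule ℂ (Fock (Orb Λ)) := nParticleSubmodule (ι := Orb Λ) (Fintype.card Λ) with hK
  obtain ⟨k, b, hk, hbV, hb1, htr⟩ := exists_frame_trace_projMatrix_map_mul (H.sectorGroundSpace K)
  have htrP : (H.sectorGroundProj K).trace = (k : ℂ) := by
    rw [Matrix.sectorGroundProj, trace_projMatrix_map_eq_finrank, ← hk]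
  have htrO : (H.sectorGroundProj K * O).trace = ∑ j, star (b j) ⬝ᵥ O *ᵥ b j := htr _
  have hbj : ∀ j, IsGroundState H (Fintype.card Λ) (b j) := by
    intro j
    refine (LiebHalfFilled.isGroundState_iff G t U _ (b j)).2 ⟨fun h0 => ?_, hbV j⟩
    have h := hb1 j
    rw [h0, dotProduct_zero] at h
    exact zero_ne_one h
  have hψV : ψ ∈ H.sectorGroundSpace K := ((LiebHalfFilled.isGroundState_iff G t U _ ψ).1 hψ).2
  have hk0 : (k : ℂ) ≠ 0 := by
    rw [hk, Nat.cast_ne_zero]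
    intro h0
    rw [Submodule.finrank_eq_zero] at h0
    rw [h0, Submodule.mem_bot] at hψV
    exact hψ.2.1 hψV
  have hterm : ∀ j, star (b j) ⬝ᵥ O *ᵥ b j * (star ψ ⬝ᵥ ψ) = star ψ ⬝ᵥ (O *ᵥ ψ) := by
    intro j
    have h := groundState_expect_mul_normSq_eq hG A hA ht hU hO hOp hOm (hbj j) hψ
    rw [hb1 j, mul_one] at h
    exact h
  rw [Matrix.projState_apply, htrP, htrO, mul_assoc, Finset.sum_mul, Finset.sum_congr rfl
    (fun j _ => hterm j), Finset.sum_const, Finset.card_univ, Fintype.card_fin, nsmul_eq_mul,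
    ← mul_assoc, inv_mul_cancel₀ hk0, one_mul]

end Multiplet

/-! ### Shen–Qiu–Tian's theorem and the ferrimagnetic floor, member by member -/

section Members

variable {Λ : Type*} [LinearOrder Λ] [Fintype Λ] {G : SimpleGraph Λ} [DecidableRel G.Adj]

/-- **Shen–Qiu–Tian / Tasaki (1998) Theorem 5.3, non-strict form, for EVERY half-filled ground
state**: on a connected bipartite graph with colour class `A`, `t ≠ 0`, `U > 0`, every ground state
`ψ` of the `N = |Λ|`-particle Hubbard Hamiltonian (any member of Lieb's multiplet, `|Λ|` of either
parity) satisfies `ε_x ε_y Re⟨ψ, 𝐒_x·𝐒_y ψ⟩ ≥ 0` for all sites `x, y` (`𝐒_x·𝐒_y` is an `SU(2)`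
scalar, so its value in `ψ` is the tracial value `HalfFilledGroundState.sign_rule` times `‖ψ‖²`).
[cite: ShenQiuTian1994, Theorem and eqs. (7)–(9)] [cite: Tasaki1998, Theorem 5.3] -/
theorem groundState_sign_rule_spinDot (hG : G.Connected) (A : Finset Λ)
    (hA : ∀ x y : Λ, G.Adj x y → (x ∈ A ↔ y ∉ A)) {t U : ℝ} (ht : t ≠ 0) (hU : 0 < U)
    {ψ : Fock (Orb Λ)} (hψ : IsGroundState (hamiltonian G t U) (Fintype.card Λ) ψ) (x y : Λ) :
    0 ≤ (stagSign A x * stagSign A y * (star ψ ⬝ᵥ (fermionSpinDot x y *ᵥ ψ))).re := by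
  have h := projState_mul_normSq_eq_expect hG A hA ht hU (preservesSectors_fermionSpinDot x y)
    (fermionSpinDot_commute_spinPlus x y) (fermionSpinDot_commute_spinMinus x y) hψ
  rw [← h, ← mul_assoc]
  have hω := HalfFilledGroundState.sign_rule hG A hA ht hU x y
  exact (Complex.nonneg_iff.1 (mul_nonneg hω (dotProduct_star_self_nonneg ψ))).1

omit [Fintype Λ] in
/-- `ε_x ε_y = 1` on equal sublattices. [cite: LiebPRL1989, Theorem 2] -/
private theorem membersAux_stagSign_mul_of_iff {A : Finset Λ} {x y : Λ} (h : x ∈ A ↔ y ∈ A) :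
    stagSign A x * stagSign A y = 1 := by
  unfold stagSign
  by_cases hx : x ∈ A
  · rw [if_pos hx, if_pos (h.1 hx), one_mul]
  · rw [if_neg hx, if_neg (fun hy => hx (h.2 hy))]; norm_num

omit [Fintype Λ] in
/-- `ε_x ε_y = -1` on opposite sublattices. [cite: LiebPRL1989, Theorem 2] -/
private theorem membersAux_stagSign_mul_of_iff_not {A : Finset Λ} {x y : Λ} (h : x ∈ A ↔ y ∉ A) :
    stagSign A x * stagSign A y = -1 := by
  unfold stagSign
  by_cases hx : x ∈ A
  · rw [if_pos hx, if_neg (h.1 hx), one_mul]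
  · rw [if_neg hx, if_pos (by_contra fun hy => hx (h.2 hy))]; norm_num

/-- **Equal sublattices are ferromagnetically correlated in every half-filled ground state**:
`Re⟨ψ, 𝐒_x·𝐒_y ψ⟩ ≥ 0` if `x, y` lie on the same sublattice.
[cite: ShenQiuTian1994, Theorem and eqs. (7)–(9)] [cite: Tasaki1998, Theorem 5.3] -/
theorem groundState_fermionSpinDot_nonneg_of_same (hG : G.Connected) (A : Finset Λ)
    (hA : ∀ x y : Λ, G.Adj x y → (x ∈ A ↔ y ∉ A)) {t U : ℝ} (ht : t ≠ 0) (hU : 0 < U)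
    {ψ : Fock (Orb Λ)} (hψ : IsGroundState (hamiltonian G t U) (Fintype.card Λ) ψ) {x y : Λ}
    (hxy : x ∈ A ↔ y ∈ A) : 0 ≤ (star ψ ⬝ᵥ (fermionSpinDot x y *ᵥ ψ)).re := by
  have h := groundState_sign_rule_spinDot hG A hA ht hU hψ x y
  rwa [membersAux_stagSign_mul_of_iff hxy, one_mul] at h

/-- **Opposite sublattices are antiferromagnetically correlated in every half-filled ground
state**: `Re⟨ψ, 𝐒_x·𝐒_y ψ⟩ ≤ 0` if `x, y` lie on opposite sublattices.
[cite: ShenQiuTian1994, Theorem and eqs. (7)–(9)] [cite: Tasaki1998, Theorem 5.3] -/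
theorem groundState_fermionSpinDot_nonpos_of_opposite (hG : G.Connected) (A : Finset Λ)
    (hA : ∀ x y : Λ, G.Adj x y → (x ∈ A ↔ y ∉ A)) {t U : ℝ} (ht : t ≠ 0) (hU : 0 < U)
    {ψ : Fock (Orb Λ)} (hψ : IsGroundState (hamiltonian G t U) (Fintype.card Λ) ψ) {x y : Λ}
    (hxy : x ∈ A ↔ y ∉ A) : (star ψ ⬝ᵥ (fermionSpinDot x y *ᵥ ψ)).re ≤ 0 := by
  have h := groundState_sign_rule_spinDot hG A hA ht hU hψ x y
  rw [membersAux_stagSign_mul_of_iff_not hxy, neg_one_mul, Complex.neg_re] at h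
  linarith

/-- **Every bond is antiferromagnetically correlated in every half-filled ground state**:
`Re⟨ψ, 𝐒_x·𝐒_y ψ⟩ ≤ 0` for adjacent `x ∼ y`. [cite: ShenQiuTian1994, Theorem and eqs. (7)–(9)]
[cite: Tasaki1998, Theorem 5.3] -/
theorem groundState_fermionSpinDot_nonpos_of_adj (hG : G.Connected) (A : Finset Λ)
    (hA : ∀ x y : Λ, G.Adj x y → (x ∈ A ↔ y ∉ A)) {t U : ℝ} (ht : t ≠ 0) (hU : 0 < U)
    {ψ : Fock (Orb Λ)} (hψ : IsGroundState (hamiltonian G t U) (Fintype.card Λ) ψ) {x y : Λ}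
    (hxy : G.Adj x y) : (star ψ ⬝ᵥ (fermionSpinDot x y *ᵥ ψ)).re ≤ 0 :=
  groundState_fermionSpinDot_nonpos_of_opposite hG A hA ht hU hψ (hA x y hxy)

/-- **The ferrimagnetic floor for EVERY half-filled ground state** (`|Λ|` even; the
`TODO(general member)` of `HubbardFerrimagneticOrder`, there only for the `S^z = 0` member):
`Re⟨ψ, 𝓢_A ψ⟩ ≥ S₀(S₀+1) ‖ψ‖²`, `𝓢_A = Σ ε_x ε_y 𝐒_x·𝐒_y`, `S₀ = ||A| - |Aᶜ||/2`
(`𝓢_A` is an `SU(2)` scalar; tracial floor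
`HalfFilledGroundState.liebSpin_le_re_projState_stagSpinStructure`).
[cite: ShenQiuTian1994, Theorem and eqs. (7)–(9)] [cite: Tasaki1998, §5.3] -/
theorem groundState_liebSpin_le_re_expect_stagSpinStructure (hG : G.Connected) (A : Finset Λ)
    (hA : ∀ x y : Λ, G.Adj x y → (x ∈ A ↔ y ∉ A)) (hΛ : Even (Fintype.card Λ))
    {t U : ℝ} (ht : t ≠ 0) (hU : 0 < U)
    {ψ : Fock (Orb Λ)} (hψ : IsGroundState (hamiltonian G t U) (Fintype.card Λ) ψ) :
    liebSpin A * (liebSpin A + 1) * (star ψ ⬝ᵥ ψ).re ≤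
      (star ψ ⬝ᵥ (stagSpinStructure A *ᵥ ψ)).re := by
  have h := projState_mul_normSq_eq_expect hG A hA ht hU (preservesSectors_stagSpinStructure A)
    (stagSpinStructure_commute_spinPlus A) (stagSpinStructure_commute_spinMinus A) hψ
  have hω := HalfFilledGroundState.liebSpin_le_re_projState_stagSpinStructure hG A hA hΛ ht hU
  have hn : 0 ≤ (star ψ ⬝ᵥ ψ).re := (Complex.nonneg_iff.1 (dotProduct_star_self_nonneg ψ)).1
  have him : (star ψ ⬝ᵥ ψ).im = 0 := (Complex.nonneg_iff.1 (dotProduct_star_self_nonneg ψ)).2.symm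
  rw [← h, Complex.mul_re, him, mul_zero, sub_zero]
  exact mul_le_mul_of_nonneg_right hω hn

/-- **Long-range ferrimagnetic order, every member**: `Re⟨ψ, 𝓢_A ψ⟩ ≥ ¼(|A| - |Aᶜ|)² ‖ψ‖²` for
every half-filled ground state (`|Λ|` even). [cite: ShenQiuTian1994, Theorem and eqs. (7)–(9)]
[cite: Tasaki1998, §5.3] -/
theorem groundState_sq_card_sub_le_re_expect_stagSpinStructure (hG : G.Connected) (A : Finset Λ)
    (hA : ∀ x y : Λ, G.Adj x y → (x ∈ A ↔ y ∉ A)) (hΛ : Even (Fintype.card Λ))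
    {t U : ℝ} (ht : t ≠ 0) (hU : 0 < U)
    {ψ : Fock (Orb Λ)} (hψ : IsGroundState (hamiltonian G t U) (Fintype.card Λ) ψ) :
    ((A.card : ℝ) - (Aᶜ.card : ℝ)) ^ 2 / 4 * (star ψ ⬝ᵥ ψ).re ≤
      (star ψ ⬝ᵥ (stagSpinStructure A *ᵥ ψ)).re := by
  have hn : 0 ≤ (star ψ ⬝ᵥ ψ).re := (Complex.nonneg_iff.1 (dotProduct_star_self_nonneg ψ)).1
  exact le_trans (mul_le_mul_of_nonneg_right (sq_card_sub_div_four_le_liebSpin A) hn)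
    (groundState_liebSpin_le_re_expect_stagSpinStructure hG A hA hΛ ht hU hψ)

end Members

end Literature.MathematicalPhysics.QuantumLattice

end
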